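import Summits.NavierStokesRegularity.FunctionalMining.TopEigAmplitudeFloorHolds
import HarnessLib

/-!
# FunctionalMining / NoGo — K57a: the AMPLITUDE FLOOR (LEMMA AF) on the WHOLE range `q > 1`
# (door D-K6 (b) below `q = 2`, kernel side: the Fatou form of the treeʼs `q ≥ 2` theorem)

HONEST FRAMING. Search for candidate a priori estimates; no regularity claim. Nothing about
Navier–Stokes is proved or asserted in this file. Cell `pub-nsfunc`, no-go seat (gen 53, touch 2).
Static calculus of smooth fields on the flat torus.

CONTEXT. Door (b)/(F2) of `NOGO.md` = the WANTED kernel negation `¬ TopEigHeatCoercivePos q` of the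
open node Lemma L-λ(q) (`TopEigHeatCoercive.lean`, OPEN in the kernel ∀ real `q > 1`). The treeʼs
AMPLITUDE FLOOR `topEigAmplitudeFloor_of_two_le` (LEMMA AF: `q(q−1) ∫ λ^{q−2} Σᵢ(∂ᵢλ)² ≤
heatDissipation Φ_q v`, `λ := λ₁ ∘ S_v`) and what rests on it (K53 ISO-TOP, K53b) are kernel for
real `q ≥ 2` ONLY: the limit step is dominated convergence with the line-Lipschitz bound of the
weight `qλ^{q−1}`, unavailable below `2` (`s ↦ s^{q−1}` is not Lipschitz at `0`; `λ ≥ 0` has zeros).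
THE OBSERVATION. In the treeʼs discrete inequality — for every `t > 0`, with `φ := qλ^{q−1}`,
`Σᵢ ∫ [(φ(x+teᵢ) − φ(x))/t]·[(λ(x+teᵢ) − λ(x))/t] dx ≤ heatDissipation Φ_q v + C·t` — the integrand
is POINTWISE NON-NEGATIVE for every `q ≥ 1` (`s ↦ qs^{q−1}` is MONOTONE on `[0, ∞)`), so FATOU
along `𝓝[>] 0` replaces dominated convergence and no bound on the weight is needed. The lower limit
is the floor integrand a.e.: at a Rademacher point of the Lipschitz `λ` with `λ(x) > 0` the slopes
converge (chain rule at a non-zero base, any real exponent); where `λ(x) = 0` — a global minimum —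
EVERY junk-valued partial `∂ᵢλ(x) = deriv (t ↦ λ(x+teᵢ)) 0` vanishes (Fermat, differentiable or
not), so the integrand is `0` there whatever `Real.rpow` makes of `0^{q−2}`.

CONTENT (every finite index type `d`; junk-valued `Torus.partialDeriv`): § 1 (`TopEig.FloorLow`)
tools — measurable partials of a continuous torus function, Fermat at a global minimum, non-negative
slope products, their limit at a Rademacher point with `λ > 0`; § 2
**`FloorLow.exists_sum_integral_slope_mul_slope_le`**, the DISCRETE FLOOR above (every real `q ≥ 1`,
`t > 0`; the treeʼs architecture: `exists_topEig_secondDiff_ge`, `integral_mul_secondDiff_eq`,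
Danskin); § 3 **`FloorLow.heatDissipation_topEigMoment_nonneg`** (`q ≥ 1`, every `d`),
**`FloorLow.integrable_floorIntegrand_and_integral_le`** (Fatou: ∀ real `q > 1` the floor integrand
is INTEGRABLE with integral `≤ heatDissipation Φ_q v`) and the node
**`topEigAmplitudeFloor_of_one_lt (hq : 1 < q) : TopEigAmplitudeFloor q`**. Sequel K57b
(`NoGo/TopEigHeatIsoTopLow`): ISO-TOP and EXACT ONCE ⇒ EXACT ALWAYS from ANY exponent `q > 1`.
NOT here: any verdict change (L-λ(q) OPEN in the kernel ∀ real q > 1; door (b) on paper: RULING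
(ζζ)); no 𝒦₀ row, no A12 count, no T_LD. [ours = §§ 2–3; folklore = § 1, Fatou, Rademacher]
FILING (prove seat g30, REQUEST #85): declarations byte-identical to the no-go seat's staged `TopEigAmplitudeFloorLow.STAGING.lean` 5fafbccab8bacb41; this line is the only addition; ONE blank line (staged l.42, the empty line after `noncomputable section`) is removed so that the gate's line count (newlines + 1) is 400 — RULING (ω) normal form, no declaration touched.
-/

noncomputable section
open MeasureTheory Set Filter Topology
open scoped NNReal ENNReal

namespace Summit.NavierStokesRegularity.FunctionalMining

open Literature.Analysis.FunctionSpaces Literature.Analysis.FluidPDE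

variable {d : Type*} [Fintype d] [DecidableEq d]

namespace TopEig

namespace FloorLow

open StrainL4

/-! ## § 1 Tools: measurable partials, Fermat, monotone slopes, the pointwise limit at `λ₁ > 0` -/

section Tools
/-- The junk-valued partial `x ↦ ∂ᵢ f(x) = deriv (t ↦ f(x + teᵢ)) 0` of a CONTINUOUS function on
`T^d` is measurable (Mathlib `measurable_deriv_with_param`, `(x, t) ↦ f(x + teᵢ)` continuous). -/
theorem measurable_partialDeriv_of_continuous {f : UnitAddTorus d → ℝ} (hf : Continuous f) (i : d) :
    Measurable (Torus.partialDeriv i f) := by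
  have hc : Continuous (Function.uncurry fun (x : UnitAddTorus d) (t : ℝ) =>
      f (x + Torus.proj (t • EuclideanSpace.single i (1 : ℝ)))) :=
    hf.comp (continuous_fst.add (Torus.continuous_proj.comp (continuous_snd.smul continuous_const)))
  exact (measurable_deriv_with_param hc).comp (measurable_id.prodMk measurable_const)

omit [Fintype d] in
/-- **Fermat for the junk-valued partials.** At a global minimum point of `f : T^d → ℝ` every
partial vanishes, differentiable or not (`IsLocalMin.deriv_eq_zero`, junk value included). -/
theorem partialDeriv_eq_zero_of_globalMin {f : UnitAddTorus d → ℝ} {x : UnitAddTorus d}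
    (hmin : ∀ z, f x ≤ f z) (i : d) : Torus.partialDeriv i f x = 0 := by
  have hloc :
      IsLocalMin (fun t : ℝ => f (x + Torus.proj (t • EuclideanSpace.single i (1 : ℝ)))) 0 :=
    Filter.Eventually.of_forall fun t => by
      show f (x + Torus.proj ((0 : ℝ) • EuclideanSpace.single i (1 : ℝ))) ≤ _
      rw [zero_smul, Torus.proj_zero, add_zero]; exact hmin _
  exact hloc.deriv_eq_zero

omit [Fintype d] [DecidableEq d] in
/-- **Monotone weight ⇒ non-negative slope products.** For `q ≥ 1`, `a, b ≥ 0` and any `t`: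
`0 ≤ [(q a^{q−1} − q b^{q−1})/t]·[(a − b)/t]` (`s ↦ s^{q−1}` is monotone on `[0, ∞)`). [folklore] -/
theorem slope_mul_slope_nonneg {q a b t : ℝ} (hq : 1 ≤ q) (ha : 0 ≤ a) (hb : 0 ≤ b) :
    0 ≤ (q * a ^ (q - 1) - q * b ^ (q - 1)) / t * ((a - b) / t) := by
  have key : 0 ≤ (a ^ (q - 1) - b ^ (q - 1)) * (a - b) := by
    rcases le_total a b with hab | hab
    · have h1 : a ^ (q - 1) ≤ b ^ (q - 1) := Real.rpow_le_rpow ha hab (by linarith)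
      nlinarith
    · have h1 : b ^ (q - 1) ≤ a ^ (q - 1) := Real.rpow_le_rpow hb hab (by linarith)
      nlinarith
  rw [div_mul_div_comm, ← mul_sub, mul_assoc]
  exact div_nonneg (mul_nonneg (by linarith) key) (mul_self_nonneg t)

/-- **The pointwise limit at a Rademacher point with `λ₁ > 0`, every real `q`.** With
`λ := λ₁ ∘ S_v` differentiable at `x` (re-centred lift) and `λ(x) > 0`:
`[(qλ(x+teᵢ)^{q−1} − qλ(x)^{q−1})/t]·[(λ(x+teᵢ) − λ(x))/t] → q(q−1)λ(x)^{q−2}(∂ᵢλ(x))²` as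
`t → 0⁺` (chain rule for `s ↦ s^{q−1}` at the non-zero base `λ(x)`). [ours] -/
theorem tendsto_slope_mul_slope_of_pos {v : UnitAddTorus d → EuclideanSpace ℝ d} (q : ℝ)
    {x : UnitAddTorus d} (hx : DifferentiableAt ℝ (Torus.liftAt (torusStrainTopEig v) x) 0)
    (hpos : 0 < torusStrainTopEig v x) (i : d) :
    Tendsto (fun t : ℝ =>
        (q * torusStrainTopEig v (x + Torus.proj (t • EuclideanSpace.single i (1 : ℝ))) ^ (q - 1) -
            q * torusStrainTopEig v x ^ (q - 1)) / t *
          ((torusStrainTopEig v (x + Torus.proj (t • EuclideanSpace.single i (1 : ℝ))) -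
            torusStrainTopEig v x) / t))
      (𝓝[>] 0)
      (𝓝 (q * (q - 1) * torusStrainTopEig v x ^ (q - 2) *
        Torus.partialDeriv i (torusStrainTopEig v) x ^ 2)) := by
  set L := torusStrainTopEig v with hL
  set u : EuclideanSpace ℝ d := EuclideanSpace.single i (1 : ℝ) with hu
  have hD := hasDerivAt_topEig_translate hx u
  have hpd : Torus.partialDeriv i L x = Torus.fderiv L x u := partialDeriv_topEig_eq hx i
  have hsL : Tendsto (fun t : ℝ => (L (x + Torus.proj (t • u)) - L x) / t) (𝓝[>] 0)
      (𝓝 (Torus.fderiv L x u)) := by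
    have h := tendsto_div_of_hasDerivAt_zero hD
    simpa only [zero_smul, Torus.proj_zero, add_zero] using h
  have hx0 : (fun t : ℝ => L (x + Torus.proj (t • u))) 0 ≠ 0 := by
    show L (x + Torus.proj ((0 : ℝ) • u)) ≠ 0
    rw [zero_smul, Torus.proj_zero, add_zero]; exact hpos.ne'
  have hφD : HasDerivAt (fun t : ℝ => q * L (x + Torus.proj (t • u)) ^ (q - 1))
      (q * (Torus.fderiv L x u * (q - 1) *
        L (x + Torus.proj ((0 : ℝ) • u)) ^ (q - 1 - 1))) 0 :=
    (hD.rpow_const (p := q - 1) (Or.inl hx0)).const_mul q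
  have hsφ : Tendsto (fun t : ℝ =>
      (q * L (x + Torus.proj (t • u)) ^ (q - 1) - q * L x ^ (q - 1)) / t)
      (𝓝[>] 0) (𝓝 (q * (Torus.fderiv L x u * (q - 1) * L x ^ (q - 2)))) := by
    have h := tendsto_div_of_hasDerivAt_zero hφD
    have e : q - 1 - 1 = q - 2 := by ring
    simpa only [zero_smul, Torus.proj_zero, add_zero, e] using h
  have hprod := hsφ.mul hsL
  have e : q * (Torus.fderiv L x u * (q - 1) * L x ^ (q - 2)) * Torus.fderiv L x u =
      q * (q - 1) * L x ^ (q - 2) * Torus.partialDeriv i L x ^ 2 := by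
    rw [hpd]; ring
  rw [← e]
  exact hprod

end Tools

/-! ## § 2 The discrete floor (every real `q ≥ 1`, every `t > 0`) -/

section Discrete

variable [Nonempty d]
variable {v : UnitAddTorus d → EuclideanSpace ℝ d} {q : ℝ}

/-- **The DISCRETE AMPLITUDE FLOOR (every real `q ≥ 1`).** For smooth divergence-free `v` on `T^d`,
`λ := λ₁ ∘ S_v`, there is `C` with, for every `t > 0`,
`Σᵢ ∫ [(qλ(x+teᵢ)^{q−1} − qλ(x)^{q−1})/t]·[(λ(x+teᵢ) − λ(x))/t] dx ≤ heatDissipation Φ_q v + C t`: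
the treeʼs pointwise second-difference inequality (`exists_topEig_secondDiff_ge`) integrated against
`qλ^{q−1} ≥ 0`, discrete integration by parts per axis (`integral_mul_secondDiff_eq`), division by
`t²`, and Danskinʼs formula (`heatDissipation_topEigMoment_eq_integral`). Same architecture as the
treeʼs `topEigAmplitudeFloor_of_two_le`, which states only the `t → 0⁺` limit for `q ≥ 2`. [ours] -/
theorem exists_sum_integral_slope_mul_slope_le (hq : 1 ≤ q) (hv : Torus.IsSmooth v)
    (hdv : Torus.IsDivFree v) : ∃ C : ℝ, ∀ t : ℝ, 0 < t →
      ∑ i, ∫ x,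
        (q * torusStrainTopEig v (x + Torus.proj (t • EuclideanSpace.single i (1 : ℝ))) ^ (q - 1) -
            q * torusStrainTopEig v x ^ (q - 1)) / t *
          ((torusStrainTopEig v (x + Torus.proj (t • EuclideanSpace.single i (1 : ℝ))) -
            torusStrainTopEig v x) / t) ≤
        heatDissipation (torusTopEigMoment q) v + C * t := by
  set L := torusStrainTopEig v with hL
  obtain ⟨C, hC⟩ := exists_topEig_secondDiff_ge hv
  have hLc : Continuous L := continuous_torusStrainTopEig hv
  have hLnn : ∀ y, 0 ≤ L y := fun y => by
    rw [hL, ← lam_strainFlat]; exact lam_strainFlat_nonneg hv hdv y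
  have hφc : Continuous fun x => q * L x ^ (q - 1) :=
    continuous_const.mul (hLc.rpow_const fun _ => Or.inr (by linarith))
  have hφnn : ∀ x, 0 ≤ q * L x ^ (q - 1) := fun x =>
    mul_nonneg (by linarith) (Real.rpow_nonneg (hLnn x) _)
  have hφi : Integrable (fun x => q * L x ^ (q - 1)) volume := hφc.integrable_unitAddTorus
  have hint : Integrable (fun x => q * L x ^ (q - 1) *
      dirTopEig (strainFlat v x) (strainFlat (Torus.laplacian v) x)) volume :=
    integrable_danskinDensity hq hv hv.laplacian hdv
  have hDc : ∀ (t : ℝ) (i : d), Continuous fun x =>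
      L (x + Torus.proj (t • EuclideanSpace.single i (1 : ℝ))) +
        L (x + Torus.proj ((-t) • EuclideanSpace.single i (1 : ℝ))) - 2 * L x := fun t i =>
    ((hLc.comp (continuous_id.add continuous_const)).add
      (hLc.comp (continuous_id.add continuous_const))).sub (continuous_const.mul hLc)
  refine ⟨C * ∫ x, q * L x ^ (q - 1), fun t ht => ?_⟩
  have ht0 : t ≠ 0 := ht.ne'
  have hpt : ∀ x, q * L x ^ (q - 1) *
      (t ^ 2 * dirTopEig (strainFlat v x) (strainFlat (Torus.laplacian v) x) - C * t ^ 3) ≤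
      q * L x ^ (q - 1) * ∑ i, (L (x + Torus.proj (t • EuclideanSpace.single i (1 : ℝ))) +
        L (x + Torus.proj ((-t) • EuclideanSpace.single i (1 : ℝ))) - 2 * L x) := by
    intro x
    have h := hC x t
    rw [abs_of_pos ht] at h
    exact mul_le_mul_of_nonneg_left h (hφnn x)
  have e1 : (fun x => q * L x ^ (q - 1) *
      (t ^ 2 * dirTopEig (strainFlat v x) (strainFlat (Torus.laplacian v) x) - C * t ^ 3)) =
      fun x => t ^ 2 * (q * L x ^ (q - 1) *
        dirTopEig (strainFlat v x) (strainFlat (Torus.laplacian v) x)) -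
        C * t ^ 3 * (q * L x ^ (q - 1)) := by
    funext x; ring
  have hI1a : Integrable (fun x => t ^ 2 * (q * L x ^ (q - 1) *
      dirTopEig (strainFlat v x) (strainFlat (Torus.laplacian v) x))) volume := hint.const_mul _
  have hI1b : Integrable (fun x => C * t ^ 3 * (q * L x ^ (q - 1))) volume := hφi.const_mul _
  have hI1 : Integrable (fun x => q * L x ^ (q - 1) *
      (t ^ 2 * dirTopEig (strainFlat v x) (strainFlat (Torus.laplacian v) x) - C * t ^ 3))
      volume := by
    rw [e1]; exact hI1a.sub hI1b
  have hI2 : Integrable (fun x => q * L x ^ (q - 1) *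
      ∑ i, (L (x + Torus.proj (t • EuclideanSpace.single i (1 : ℝ))) +
        L (x + Torus.proj ((-t) • EuclideanSpace.single i (1 : ℝ))) - 2 * L x)) volume :=
    (hφc.mul (continuous_finsetSum _ fun i _ => hDc t i)).integrable_unitAddTorus
  have hmono := integral_mono hI1 hI2 hpt
  have hleft : ∫ x, q * L x ^ (q - 1) *
      (t ^ 2 * dirTopEig (strainFlat v x) (strainFlat (Torus.laplacian v) x) - C * t ^ 3) =
      t ^ 2 * (∫ x, q * L x ^ (q - 1) *
        dirTopEig (strainFlat v x) (strainFlat (Torus.laplacian v) x)) -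
      C * t ^ 3 * (∫ x, q * L x ^ (q - 1)) := by
    rw [e1, integral_sub hI1a hI1b, integral_const_mul, integral_const_mul]
  have hright : ∫ x, q * L x ^ (q - 1) *
      ∑ i, (L (x + Torus.proj (t • EuclideanSpace.single i (1 : ℝ))) +
        L (x + Torus.proj ((-t) • EuclideanSpace.single i (1 : ℝ))) - 2 * L x) =
      -(t ^ 2) * ∑ i, ∫ x,
        (q * L (x + Torus.proj (t • EuclideanSpace.single i (1 : ℝ))) ^ (q - 1) -
          q * L x ^ (q - 1)) / t *
        ((L (x + Torus.proj (t • EuclideanSpace.single i (1 : ℝ))) - L x) / t) := by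
    have e2 : (fun x => q * L x ^ (q - 1) *
        ∑ i, (L (x + Torus.proj (t • EuclideanSpace.single i (1 : ℝ))) +
          L (x + Torus.proj ((-t) • EuclideanSpace.single i (1 : ℝ))) - 2 * L x)) =
        fun x => ∑ i, q * L x ^ (q - 1) *
          (L (x + Torus.proj (t • EuclideanSpace.single i (1 : ℝ))) +
            L (x + Torus.proj ((-t) • EuclideanSpace.single i (1 : ℝ))) - 2 * L x) := by
      funext x; rw [Finset.mul_sum]
    have hI3 : ∀ i, Integrable (fun x => q * L x ^ (q - 1) *
        (L (x + Torus.proj (t • EuclideanSpace.single i (1 : ℝ))) +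
          L (x + Torus.proj ((-t) • EuclideanSpace.single i (1 : ℝ))) - 2 * L x)) volume :=
      fun i => (hφc.mul (hDc t i)).integrable_unitAddTorus
    rw [e2, integral_finsetSum _ (fun i _ => hI3 i), Finset.mul_sum]
    refine Finset.sum_congr rfl fun i _ => ?_
    have hibp := integral_mul_secondDiff_eq hφc hLc
      (Torus.proj (t • EuclideanSpace.single i (1 : ℝ)))
    have e3 : (fun x => q * L x ^ (q - 1) *
        (L (x + Torus.proj (t • EuclideanSpace.single i (1 : ℝ))) +
          L (x + Torus.proj ((-t) • EuclideanSpace.single i (1 : ℝ))) - 2 * L x)) =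
        fun x => q * L x ^ (q - 1) *
          (L (x + Torus.proj (t • EuclideanSpace.single i (1 : ℝ))) +
            L (x - Torus.proj (t • EuclideanSpace.single i (1 : ℝ))) - 2 * L x) := by
      funext x; rw [neg_smul, Torus.proj_neg, ← sub_eq_add_neg]
    rw [e3, hibp, neg_mul, ← integral_const_mul]
    congr 1
    refine integral_congr_ae (Filter.Eventually.of_forall fun x => ?_)
    show _ = t ^ 2 * _
    field_simp
  rw [hleft, hright] at hmono
  have ht2 : 0 < t ^ 2 := by positivity
  rw [heatDissipation_topEigMoment_eq_integral hq hv hdv]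
  refine le_of_mul_le_mul_left ?_ ht2
  have e4 : ∀ A B S : ℝ, t ^ 2 * A - C * t ^ 3 * B ≤ -(t ^ 2) * S →
      t ^ 2 * S ≤ t ^ 2 * (-A + C * B * t) := fun A B S h => by nlinarith [h]
  exact e4 _ _ _ hmono

end Discrete

/-! ## § 3 Fatou: the amplitude floor on the whole range `q > 1` -/

section Fatou

variable [Nonempty d]
variable {v : UnitAddTorus d → EuclideanSpace ℝ d} {q : ℝ}

/-- **The heat price of `Φ_q` is non-negative** (every finite `d`, smooth divergence-free `v`, real
`q ≥ 1`) — read off the discrete floor, whose left side is `≥ 0` termwise (§ 1): `0 ≤ D + C t`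
for all `t > 0`. (On `T³`: the treeʼs heat sieve `heatDissipation_nonneg_of_admissible`.) [ours] -/
theorem heatDissipation_topEigMoment_nonneg (hq : 1 ≤ q) (hv : Torus.IsSmooth v)
    (hdv : Torus.IsDivFree v) : 0 ≤ heatDissipation (torusTopEigMoment q) v := by
  set L := torusStrainTopEig v with hL
  have hLnn : ∀ y, 0 ≤ L y := fun y => by
    rw [hL, ← lam_strainFlat]; exact lam_strainFlat_nonneg hv hdv y
  obtain ⟨C, hC⟩ := exists_sum_integral_slope_mul_slope_le hq hv hdv
  have hev : ∀ t : ℝ, 0 < t → 0 ≤ heatDissipation (torusTopEigMoment q) v + C * t := fun t ht =>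
    (Finset.sum_nonneg fun i _ => integral_nonneg fun x =>
      slope_mul_slope_nonneg hq (hLnn _) (hLnn _)).trans (hC t ht)
  have hlim : Tendsto (fun t : ℝ => heatDissipation (torusTopEigMoment q) v + C * t) (𝓝[>] 0)
      (𝓝 (heatDissipation (torusTopEigMoment q) v)) :=
    ((by fun_prop : Continuous fun t : ℝ => heatDissipation (torusTopEigMoment q) v + C * t)
      |>.tendsto' 0 _ (by simp)).mono_left nhdsWithin_le_nhds
  exact ge_of_tendsto hlim (eventually_nhdsWithin_of_forall hev)

/-- **LEMMA AF ON THE WHOLE RANGE — the Fatou form.** For smooth divergence-free `v` on `T^d`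
(every finite `d`) and every real `q > 1`, the floor integrand `q(q−1) λ^{q−2} Σᵢ(∂ᵢλ)²` is
INTEGRABLE and `∫ q(q−1) λ^{q−2} Σᵢ(∂ᵢλ)² ≤ heatDissipation Φ_q v`: Fatou along `𝓝[>] 0` for the
non-negative continuous slope products of § 2 (lower limit = the floor integrand a.e.: § 1 at
Rademacher points with `λ > 0`; `0` at the zeros of `λ`, where every partial vanishes by Fermat),
against the discrete floor `≤ heatDissipation Φ_q v + C t`. [ours] -/
theorem integrable_floorIntegrand_and_integral_le (hq : 1 < q) (hv : Torus.IsSmooth v)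
    (hdv : Torus.IsDivFree v) :
    Integrable (fun x => q * (q - 1) * (torusStrainTopEig v x ^ (q - 2) *
      ∑ i, Torus.partialDeriv i (torusStrainTopEig v) x ^ 2)) volume ∧
    ∫ x, q * (q - 1) * (torusStrainTopEig v x ^ (q - 2) *
      ∑ i, Torus.partialDeriv i (torusStrainTopEig v) x ^ 2) ≤
      heatDissipation (torusTopEigMoment q) v := by
  set L := torusStrainTopEig v with hL
  set D := heatDissipation (torusTopEigMoment q) v with hDdef
  have hq1 : (1 : ℝ) ≤ q := hq.le
  have hLc : Continuous L := continuous_torusStrainTopEig hv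
  have hLnn : ∀ y, 0 ≤ L y := fun y => by
    rw [hL, ← lam_strainFlat]; exact lam_strainFlat_nonneg hv hdv y
  obtain ⟨K, hK⟩ := exists_lipschitzWith_torusStrainTopEig hv
  obtain ⟨C, hC⟩ := exists_sum_integral_slope_mul_slope_le hq1 hv hdv
  have hD : 0 ≤ D := heatDissipation_topEigMoment_nonneg hq1 hv hdv
  set G : ℝ → UnitAddTorus d → ℝ := fun t x => ∑ i,
    (q * L (x + Torus.proj (t • EuclideanSpace.single i (1 : ℝ))) ^ (q - 1) - q * L x ^ (q - 1)) /
      t * ((L (x + Torus.proj (t • EuclideanSpace.single i (1 : ℝ))) - L x) / t) with hG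
  set g : UnitAddTorus d → ℝ := fun x => q * (q - 1) * (L x ^ (q - 2) *
    ∑ i, Torus.partialDeriv i L x ^ 2) with hg
  have hGnn : ∀ t x, 0 ≤ G t x := fun t x =>
    Finset.sum_nonneg fun i _ => slope_mul_slope_nonneg hq1 (hLnn _) (hLnn _)
  have hφc : Continuous fun x => q * L x ^ (q - 1) :=
    continuous_const.mul (hLc.rpow_const fun _ => Or.inr (by linarith))
  have hGic : ∀ (t : ℝ) (i : d), Continuous fun x : UnitAddTorus d =>
      (q * L (x + Torus.proj (t • EuclideanSpace.single i (1 : ℝ))) ^ (q - 1) - q * L x ^ (q - 1)) /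
        t * ((L (x + Torus.proj (t • EuclideanSpace.single i (1 : ℝ))) - L x) / t) := fun t i => by
    have hsh : Continuous fun x : UnitAddTorus d =>
        x + Torus.proj (t • EuclideanSpace.single i (1 : ℝ)) := continuous_id.add continuous_const
    exact (((hφc.comp hsh).sub hφc).div_const t).mul (((hLc.comp hsh).sub hLc).div_const t)
  have hGc : ∀ t, Continuous (G t) := fun t => continuous_finsetSum _ fun i _ => hGic t i
  have hGint : ∀ t, 0 < t → ∫ x, G t x ≤ D + C * t := fun t ht => by
    have e : ∫ x, G t x = _ :=
      integral_finsetSum _ fun i (_ : i ∈ Finset.univ) => (hGic t i).integrable_unitAddTorus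
    exact e.trans_le (hC t ht)
  have hgnn : ∀ x, 0 ≤ g x := fun x => mul_nonneg (mul_nonneg (by linarith) (by linarith))
    (mul_nonneg (Real.rpow_nonneg (hLnn x) _) (Finset.sum_nonneg fun i _ => sq_nonneg _))
  have hgm : Measurable g := measurable_const.mul ((hLc.measurable.pow_const _).mul
    (Finset.measurable_sum _ fun i _ => (measurable_partialDeriv_of_continuous hLc i).pow_const _))
  -- a.e. identification of the lower limit
  have hae : ∀ᵐ x ∂(volume : Measure (UnitAddTorus d)),
      ENNReal.ofReal (g x) ≤ liminf (fun t => ENNReal.ofReal (G t x)) (𝓝[>] 0) := by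
    filter_upwards [Torus.ae_differentiableAt_liftAt hK] with x hx
    rcases eq_or_lt_of_le (hLnn x) with h0 | hpos
    · -- `λ(x) = 0`: every partial vanishes (Fermat), the floor integrand is `0`
      have hpd : ∀ i, Torus.partialDeriv i L x = 0 := fun i =>
        partialDeriv_eq_zero_of_globalMin (fun z => by rw [← h0]; exact hLnn z) i
      have hg0 : g x = 0 := by simp [hg, hpd]
      rw [hg0, ENNReal.ofReal_zero]
      exact zero_le
    · -- `λ(x) > 0`: the slope products converge to the floor integrand
      have hGx : Tendsto (fun t => G t x) (𝓝[>] 0) (𝓝 (g x)) := by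
        have hsum := tendsto_finsetSum Finset.univ fun i (_ : i ∈ Finset.univ) =>
          tendsto_slope_mul_slope_of_pos q hx hpos i
        have e : ∑ i ∈ Finset.univ, q * (q - 1) * L x ^ (q - 2) * Torus.partialDeriv i L x ^ 2 =
            g x := by
          simp only [hg, Finset.mul_sum]
          refine Finset.sum_congr rfl fun i _ => ?_
          ring
        rw [← e]
        exact hsum.congr fun t => rfl
      rw [(ENNReal.tendsto_ofReal hGx).liminf_eq]
  -- Fatou along `𝓝[>] 0`
  have hFatou : ∫⁻ x, liminf (fun t => ENNReal.ofReal (G t x)) (𝓝[>] (0 : ℝ)) ∂volume ≤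
      liminf (fun t => ∫⁻ x, ENNReal.ofReal (G t x) ∂volume) (𝓝[>] (0 : ℝ)) :=
    lintegral_liminf_le' fun t => (hGc t).measurable.ennreal_ofReal.aemeasurable
  have hRHS : liminf (fun t => ∫⁻ x, ENNReal.ofReal (G t x) ∂volume) (𝓝[>] (0 : ℝ)) ≤
      ENNReal.ofReal D := by
    have h2 : ∀ᶠ t in 𝓝[>] (0 : ℝ), ∫⁻ x, ENNReal.ofReal (G t x) ∂volume ≤
        ENNReal.ofReal (D + C * t) := by
      refine eventually_nhdsWithin_of_forall fun t ht => ?_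
      rw [← ofReal_integral_eq_lintegral_ofReal (hGc t).integrable_unitAddTorus
        (ae_of_all _ (hGnn t))]
      exact ENNReal.ofReal_le_ofReal (hGint t ht)
    have h3 : Tendsto (fun t : ℝ => ENNReal.ofReal (D + C * t)) (𝓝[>] 0)
        (𝓝 (ENNReal.ofReal D)) := ENNReal.tendsto_ofReal
      (((by fun_prop : Continuous fun t : ℝ => D + C * t).tendsto' 0 _ (by simp)).mono_left
        nhdsWithin_le_nhds)
    rw [← h3.liminf_eq]
    exact liminf_le_liminf h2
  have hle : ∫⁻ x, ENNReal.ofReal (g x) ∂volume ≤ ENNReal.ofReal D :=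
    ((lintegral_mono_ae hae).trans hFatou).trans hRHS
  have hgi : Integrable g volume :=
    ⟨hgm.aestronglyMeasurable, (hasFiniteIntegral_iff_ofReal (ae_of_all _ hgnn)).2
      (hle.trans_lt ENNReal.ofReal_lt_top)⟩
  refine ⟨hgi, ?_⟩
  rw [integral_eq_lintegral_of_nonneg_ae (ae_of_all _ hgnn) hgm.aestronglyMeasurable]
  exact (ENNReal.toReal_mono ENNReal.ofReal_ne_top hle).trans_eq (ENNReal.toReal_ofReal hD)

end Fatou

end FloorLow

end TopEig

/-- **LEMMA AF on the whole range: `TopEigAmplitudeFloor q` holds for every real `q > 1`.**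
`q(q−1) ∫ λ^{q−2} Σᵢ(∂ᵢλ)² ≤ heatDissipation Φ_q v` for smooth divergence-free `v` on `T³`
(`λ := λ₁ ∘ S_v`, junk-valued `Torus.partialDeriv`). Extends the treeʼs
`topEigAmplitudeFloor_of_two_le` (`q ≥ 2`, dominated convergence) by Fatou; door D-K6 (b) of
`NOGO.md` below `q = 2`, kernel side. [ours] -/
theorem topEigAmplitudeFloor_of_one_lt {q : ℝ} (hq : 1 < q) : TopEigAmplitudeFloor (d := d) q := by
  intro hd v hv hdv
  haveI : Nonempty d := Fintype.card_pos_iff.mp (by omega)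
  have h := (TopEig.FloorLow.integrable_floorIntegrand_and_integral_le hq hv hdv).2
  rwa [integral_const_mul] at h

end Summit.NavierStokesRegularity.FunctionalMining

end
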